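import Summits.QuantumFields.YangMills.Theorems.BalabanUVNodesN15TwoSpacingGluingCurvedKnitCovariantAveragingPair
import Summits.QuantumFields.YangMills.Theorems.BalabanUVNodesN15LiveGluedPropagatorIncrementDefect
import Summits.QuantumFields.YangMills.Theorems.BalabanUVNodesN15GenericSandwichLetters
import HarnessLib

/-!
# N15 = NE2 — PROGRAMME 𝟙P «ONE PROPAGATOR», part (𝟙P-e): THE INCREMENT ROW OF dag-n15-c's PROPAGATOR `X_q` WITH THE COVARIANT AVERAGING SUMMAND LIVE — (I-b) FOR `X_q`
# (dag-n15-a g32, FILE (𝟙P-e); node N15 = NE2; `--kind proof --supports stmt-QuantumFields-27366 --as helper`, count-neutral; theorems only, 0 def; imports n15-c 191, (I-c), (Q-1))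

WHY.  The road-(c) literal's operator layer (193b `ne2PlusOperator_sfq₄`) reads dag-n15-c's glued propagator with Bałaban's covariant averaging summand live —
`X_q(A′) := cvGlued … (e^{ηĀ′}) (P := cvNL − cvNVq(e^{ηĀ′})) (NV := cvNVq(e^{ηĀ′}))` (189a `sfqEntry0` l.52; [B9] (3.26) `P(U) = Q*(U)aQ(U) + …`, [5] (125) main term) — and
(𝟙P-c)∕(𝟙P-d) put ANY propagator with three displayed increment rows into the site∕unit sandwich.  This file proves the two LETTERS behind those rows for `X_q`, in n15-c 191∕188's own
regime (their hypothesis block verbatim): (I-b)_q — the increment `X_q − G⊗1` at both spacings — and (I-c)_q — its two-grid η-defect along King's pairing.  MECHANISM.  191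
`sfq_cvGlued_pair_spec` gives `X_q`'s block majorant and the right-inverse identity `X_q∘(Δ_U + N_L − N_V^Q(U)) = 1`; with (I) §1 `Δ_1 + N_L = Δ_a⊗1`, (1.71) `(Δ_a⊗1)(G⊗1) = 1` and FILE 28
`covLapM_eq_one_sub_speciesOpM` this is the EXACT increment identity `X_q − G⊗1 = X_q ∘ (V_R + N_V^Q(U)) ∘ (G⊗1)` (§1; (𝟙P-a)'s abstract `sub_eq_comp_comp_of_comp_sub_eq_id` pattern) —
(I) §4's identity plus ONE new summand, the covariant averaging summand itself.  The species term is (I-b)'s chain verbatim (n15-w2 `twoSidedLetters_curvCoef_one_of_meanGauge`, M1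
`hasMaj_unstackM`, FILE 21 `uniform_layer_fullGM₂`, FILE 28 `unstackM_comp_stack_eq_speciesOpM_comp`, [B11] `hasMaj_comp_exp`); the new summand is n15-c∕182b `hasMaj_nvQ` (`N_V^Q ≤
|a|K(2+K)c_δe^{3δ}e^{−δd}`, `K` = the transporter size `(1+ρ)^{(d+2)L^k} − 1`, rows∕columns of `Ad e^{ηĀ′} − 1` by 187a `sf_rows∕cols_cvT_exp_sub_one_le`) sandwiched by (Q-1).  (I-c)_q is
188 `sfq_idef_cvGlued` minus FILE 21's defect of `(G′, G)⊗1` (`idef_sub`), as (I-c).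

WHAT.  §1 ★ `sub_tensorId_gOp_eq_of_comp_eq_id_nv` ∕ `_nv_fine` (the increment identity with a summand `NV` in the glued operator), scalar budgets `amp_incr_le{,'}`.  §2 ★★
`exists_hasMaj_sfq_sub_tensorId_gOp`: in 191's regime `|X_q − G⊗1|, |X′_q − G′⊗1| ≤ K·(κ_e r_A + K_c + K_f)·e^{−δd}` (`K_c, K_f` = the two transporter sizes, `≤ O(r_A)` in the (3.35) window —
(𝟙P-e″)).  The defect row (I-c)_q is the sequel (𝟙P-e‴) `…CovariantAveragingPropagatorDefectRow`.  Operator-norm scope as 191.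

HONEST FRAMING ∕ LIMITS.  Block-majorant bookkeeping over dag-n15-c 191∕188∕182b∕187a and the lane's (I)∕FILE 21; MODEL carriers (two-spacing glued doubled torus, global small-field gauge
`u ≡ 1`, `Q(U)` = main term of [5] (125), Landau summand FLAT, `Reg336` idle, `L ≥ 7`); NOT [B9] Thm 3.1 AS PRINTED; no layer of NE2 here; N15 stays DISCHARGED OF RECORD 8∕28 AS CONSUMED
(U-blind v7 pin, p687738) — nothing re-claimed, no count moved; K3⁸ OPEN; finite 𝕋⁴ per index — NOT ℝ⁴ ∕ OS ∕ mass gap ∕ Clay.  `set_option maxHeartbeats 800000 in` ×1 ((I-b)'s budget).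
No `sorry`, `def`, `instance`, `notation`; standard axioms.
[cite: Balaban1985BackgroundPropagators, (3.26) p.395, (3.50)–(3.53) p.400, (3.59)–(3.60) p.402, (3.62)–(3.65) pp.402–403, Thm 3.1 (3.42) p.397 (shapes); Balaban1985Averaging, (124)–(126) p.36; Balaban1984PropagatorsI, (1.69) p.29,
(1.71) p.30, Prop. 1.2 (1.110)–(1.111) p.35; Balaban1984PropagatorsII, (2.52)–(2.56) pp.232–233, Lemma 2.1 (2.61) p.234; King1986, p.664 (the pairing)]
-/

noncomputable section

open scoped BigOperators Matrix

namespace Summit.QuantumFields.YangMills.BalabanUVNodes.N15.GluedZeroField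

open Literature.MathematicalPhysics.QuantumFieldTheory.Balaban1983to89
open Literature.MathematicalPhysics.QuantumFieldTheory.Balaban1983to89.B5Prop11Plancherel (Tor fine)
open Literature.MathematicalPhysics.QuantumFieldTheory.Balaban1983to89.B11SectG (BlockNorm HasMaj RowSum hasMaj_comp_exp)
open Literature.MathematicalPhysics.QuantumFieldTheory.Balaban1983to89.B6UnitTorusCarrier (unitTorusGeo unitTorusGeo_dist unitTorusGeo_dist_nonneg triangle254_unitTorusGeo rowSum_unitTorusGeo)
open Literature.MathematicalPhysics.QuantumFieldTheory.Balaban1983to89.T4EtaRateDefect (idef idef_sub)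
open Literature.MathematicalPhysics.QuantumFieldTheory.Balaban1983to89.T4EtaRateCoeffDefect (diagK pull)
open Literature.MathematicalPhysics.QuantumFieldTheory.King1986.Torus (blockOf tdistT)
open Literature.Barriers.QuantumFields (traceForm)
open Summit.QuantumFields.YangMills.BalabanUVNodes.N15.BackgroundLayer (covLapM tCoefA tCoefC gavgM speciesOpM stack unstackM blkPair hasMaj_stack hasMaj_unstackM dPiecesM₂
  dPiecesM₂_inl dPiecesM₂_inr uniform_layer_fullGM₂ unstackM_comp_stack_eq_speciesOpM_comp gaugeLetters_of_mean covLapM_eq_one_sub_speciesOpM)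
open Summit.QuantumFields.YangMills.BalabanUVNodes.N15.BackgroundModel (kappa_ofBlocks)
open Summit.QuantumFields.YangMills.BalabanUVNodes.N15.SiteLayer (hasMaj_diagK_comp_exp hasMaj_exp_mono)
open Summit.QuantumFields.YangMills.BalabanUVNodes.N15.VectorPiece (bshiftEquiv kingPrV tensorId kingPrV_bshiftEquiv_pow fibre_conn_kingPrV bshiftEquiv_comm blkFine_comp_kingPrV)
open Summit.QuantumFields.YangMills.BalabanUVNodes.N15.MatrixSpecies (coordMat basisConst basisConst_nonneg liftBlk liftMap)
open Summit.QuantumFields.YangMills.BalabanUVNodes.N15.TwoGrid (gOp)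
open Summit.QuantumFields.YangMills.BalabanUVNodes.N15.CurvedSpecies (gaugePair expTrField curvCoefC_one curvCoefA_one twoSidedLetters_curvCoef_one_of_meanGauge
  coordMat_adCLM_transpose_eq_neg_of_conjTranspose)
open Summit.QuantumFields.YangMills.BalabanUVNodes.N15.Gluing (cvM CvX CvX' cvBlk CvNorm cvNL cvNL' cvGlued cvGlued' cvT cvNVq cvNVq' gavgM_conjTranspose_of_skew conj_one_exp_eq_expTrField
  sfq_cvGlued_pair_spec sf_rows_cvT_exp_sub_one_le sf_cols_cvT_exp_sub_one_le)
open Summit.QuantumFields.YangMills.BalabanUVNodes.N15.CovAvg (hasMaj_nvQ)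
open Literature.MathematicalPhysics.QuantumFieldTheory.Balaban1983to89.Beta.AveragingCorrectionJets (adCLM)
open Literature.NumberTheory.Sieve.SquarefreeSums (exp_sub_one_le_two_mul)

variable {d : ℕ} {L : ℕ} [NeZero L]

/-! ## §1 The increment identity with a summand in the glued operator -/

section Increment

/-- ★ **THE EXACT INCREMENT IDENTITY WITH A LIVE SUMMAND** (cover's spacing): for any transport datum `R`, any summand `NV` and any RIGHT inverse `X` of `Δ_R + (N_L − NV)`,
`X − G⊗1 = X ∘ (V_R + NV) ∘ (G⊗1)` with the exact species `V_R = speciesOpM τ L^k (tCoefC η R) (tCoefA η R)` — (I) §4 plus the summand. [cite: Balaban1985BackgroundPropagators, (3.26) p.395, (3.50)–(3.53) p.400; Balaban1984PropagatorsI, (1.71) p.30] -/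
theorem sub_tensorId_gOp_eq_of_comp_eq_id_nv (mv kk : ℕ) (hL : Odd L ∧ 1 < L) {a : ℝ} (ha : 0 < a) (ι : Type) [Fintype ι] [DecidableEq ι]
    (R : Fin (d + 1) ⊕ Fin (d + 1) → CvX d L mv kk hL → Matrix ι ι ℝ) (NV X : (CvX d L mv kk hL × ι → ℝ) →ₗ[ℝ] (CvX d L mv kk hL × ι → ℝ))
    (hX : X ∘ₗ (covLapM (bshiftEquiv (cvM d L mv kk hL) (L ^ kk)) ((((L ^ kk : ℕ) : ℝ))⁻¹) R + (cvNL d L mv kk hL a ι - NV)) = LinearMap.id) :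
    X - tensorId ι (gOp (cvM d L mv kk hL) (L ^ kk) a) =
      X ∘ₗ (speciesOpM (bshiftEquiv (cvM d L mv kk hL) (L ^ kk)) ((L ^ kk : ℕ) : ℝ) (tCoefC ((((L ^ kk : ℕ) : ℝ))⁻¹) R) (tCoefA ((((L ^ kk : ℕ) : ℝ))⁻¹) R) + NV) ∘ₗ tensorId ι (gOp (cvM d L mv kk hL) (L ^ kk) a) := by
  have hLpos : 0 < L := lt_trans Nat.zero_lt_one hL.2
  have hn : 1 ≤ L ^ kk := Nat.one_le_pow kk L hLpos
  have h := sub_eq_comp_sub_comp X _ _ _ hX (tensorId_deltaOp_comp_tensorId_gOp ι (cvM d L mv kk hL) (L ^ kk) hn ha)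
  have hDT : tensorId ι (TwoGrid.deltaOp (cvM d L mv kk hL) (L ^ kk) a) - (covLapM (bshiftEquiv (cvM d L mv kk hL) (L ^ kk)) ((((L ^ kk : ℕ) : ℝ))⁻¹) R + (cvNL d L mv kk hL a ι - NV)) =
      speciesOpM (bshiftEquiv (cvM d L mv kk hL) (L ^ kk)) ((L ^ kk : ℕ) : ℝ) (tCoefC ((((L ^ kk : ℕ) : ℝ))⁻¹) R) (tCoefA ((((L ^ kk : ℕ) : ℝ))⁻¹) R) + NV := by
    rw [← covLapM_one_add_cvNL mv kk hL a ι, covLapM_eq_one_sub_speciesOpM (bshiftEquiv (cvM d L mv kk hL) (L ^ kk)) ((((L ^ kk : ℕ) : ℝ))⁻¹) R, inv_inv]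
    abel
  rw [hDT] at h
  exact h

/-- ★ The increment identity with a live summand AT THE FINE SPACING. [cite: Balaban1985BackgroundPropagators, (3.26) p.395, (3.50)–(3.53) p.400] -/
theorem sub_tensorId_gOp_eq_of_comp_eq_id_nv_fine (mv kk r : ℕ) (hL : Odd L ∧ 1 < L) {a : ℝ} (ha : 0 < a) (ι : Type) [Fintype ι] [DecidableEq ι]
    (R : Fin (d + 1) ⊕ Fin (d + 1) → CvX' d L mv kk r hL → Matrix ι ι ℝ) (NV X : (CvX' d L mv kk r hL × ι → ℝ) →ₗ[ℝ] (CvX' d L mv kk r hL × ι → ℝ))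
    (hX : X ∘ₗ (covLapM (bshiftEquiv (cvM d L mv kk hL) (L ^ r * L ^ kk)) ((((L ^ r * L ^ kk : ℕ) : ℝ))⁻¹) R + (cvNL' d L mv kk r hL a ι - NV)) = LinearMap.id) :
    X - tensorId ι (gOp (cvM d L mv kk hL) (L ^ r * L ^ kk) a) =
      X ∘ₗ (speciesOpM (bshiftEquiv (cvM d L mv kk hL) (L ^ r * L ^ kk)) ((L ^ r * L ^ kk : ℕ) : ℝ) (tCoefC ((((L ^ r * L ^ kk : ℕ) : ℝ))⁻¹) R)
        (tCoefA ((((L ^ r * L ^ kk : ℕ) : ℝ))⁻¹) R) + NV) ∘ₗ tensorId ι (gOp (cvM d L mv kk hL) (L ^ r * L ^ kk) a) := by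
  have hLpos : 0 < L := lt_trans Nat.zero_lt_one hL.2
  have hn' : 1 ≤ L ^ r * L ^ kk := Nat.one_le_iff_ne_zero.mpr (Nat.mul_ne_zero (pow_ne_zero r hLpos.ne') (pow_ne_zero kk hLpos.ne'))
  have h := sub_eq_comp_sub_comp X _ _ _ hX (tensorId_deltaOp_comp_tensorId_gOp ι (cvM d L mv kk hL) (L ^ r * L ^ kk) hn' ha)
  have hDT : tensorId ι (TwoGrid.deltaOp (cvM d L mv kk hL) (L ^ r * L ^ kk) a) -
      (covLapM (bshiftEquiv (cvM d L mv kk hL) (L ^ r * L ^ kk)) ((((L ^ r * L ^ kk : ℕ) : ℝ))⁻¹) R + (cvNL' d L mv kk r hL a ι - NV)) =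
      speciesOpM (bshiftEquiv (cvM d L mv kk hL) (L ^ r * L ^ kk)) ((L ^ r * L ^ kk : ℕ) : ℝ) (tCoefC ((((L ^ r * L ^ kk : ℕ) : ℝ))⁻¹) R) (tCoefA ((((L ^ r * L ^ kk : ℕ) : ℝ))⁻¹) R) + NV := by
    rw [← covLapM_one_add_cvNL' mv kk r hL a ι, covLapM_eq_one_sub_speciesOpM (bshiftEquiv (cvM d L mv kk hL) (L ^ r * L ^ kk)) ((((L ^ r * L ^ kk : ℕ) : ℝ))⁻¹) R, inv_inv]
    abel
  rw [hDT] at h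
  exact h

end Increment

/-- The scalar budget of (I-b)_q's two summands (kept out of the operator context). [folklore] -/
theorem amp_incr_le {B Rs κ r βG cr c₄ Rq Kc Kf K E : ℝ} (hκ : 0 ≤ κ) (hr : 0 ≤ r) (hKc : 0 ≤ Kc) (hKf : 0 ≤ Kf) (hE : 0 ≤ E) (hK : 0 ≤ K)
    (h1 : B * Rs * βG * cr ≤ K) (h2 : B * Rq * βG * cr * c₄ ≤ K) :
    B * Rs * κ * r * βG * cr * E + B * (Rq * Kc) * βG * cr * c₄ * E ≤ K * (κ * r + (Kc + Kf)) * E := by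
  have p1 := mul_le_mul_of_nonneg_right h1 (mul_nonneg (mul_nonneg hκ hr) hE)
  have p2 := mul_le_mul_of_nonneg_right h2 (mul_nonneg hKc hE)
  have p3 : 0 ≤ K * Kf * E := by positivity
  have e1 : B * Rs * κ * r * βG * cr * E = B * Rs * βG * cr * (κ * r * E) := by ring
  have e2 : B * (Rq * Kc) * βG * cr * c₄ * E = B * Rq * βG * cr * c₄ * (Kc * E) := by ring
  have e3 : K * (κ * r + (Kc + Kf)) * E = K * (κ * r * E) + K * (Kc * E) + K * Kf * E := by ring
  rw [e1, e2, e3]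
  linarith

/-- The same budget with the fine transporter size in the second summand. [folklore] -/
theorem amp_incr_le' {B Rs κ r βG cr c₄ Rq Kc Kf K E : ℝ} (hκ : 0 ≤ κ) (hr : 0 ≤ r) (hKc : 0 ≤ Kc) (hKf : 0 ≤ Kf) (hE : 0 ≤ E) (hK : 0 ≤ K)
    (h1 : B * Rs * βG * cr ≤ K) (h2 : B * Rq * βG * cr * c₄ ≤ K) :
    B * Rs * κ * r * βG * cr * E + B * (Rq * Kf) * βG * cr * c₄ * E ≤ K * (κ * r + (Kc + Kf)) * E := by
  have h := amp_incr_le (Kf := Kc) hκ hr hKf hKc hE hK h1 h2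
  have e : K * (κ * r + (Kf + Kc)) * E = K * (κ * r + (Kc + Kf)) * E := by ring
  rw [e] at h
  exact h

/-! ## §2 ★★ (I-b)_q: the increment of `X_q` over the flat pair -/

section Letter

open scoped Matrix.Norms.L2Operator

set_option maxHeartbeats 800000 in
/-- ★★ **THE INCREMENT OF dag-n15-c's `X_q` OVER THE FLAT ZERO-FIELD PAIR IS SMALL WITH THE FIELD AND THE TRANSPORTER SIZE**: `∃ δ w₀ R₀ θ₀ R₁ K > 0` (from `d, L, a, ι`) such that in 191's
regime (their hypothesis block verbatim: `k ≥ 1`, `L^m ≥ w₀`, trace-form coordinates `e`, skew-Hermitian `A′` in the C² window at scale `r_A ≤ 1`, the species window, the transporter sizes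
`K_c, K_f ≤ 1` and the two scale conditions) BOTH increments `X_q(A′) − G⊗1`, `X′_q(A′) − G′⊗1` have the block majorant `K·(κ_e r_A + K_c + K_f)·e^{−δd}` (`κ_e r_A` from the species `V_R`, (I-b)'s
chain; `K_c + K_f` from the live covariant averaging summand `N_V^Q`, n15-c∕182b). [cite: Balaban1985BackgroundPropagators, (3.62)–(3.65) pp.402–403, (3.26) p.395, (3.50)–(3.53) p.400; Balaban1985Averaging, (124)–(126) p.36; Balaban1984PropagatorsII, (2.52)–(2.56) pp.232–233] -/
theorem exists_hasMaj_sfq_sub_tensorId_gOp (hL : Odd L ∧ 1 < L) (hL7 : 7 ≤ L) {a : ℝ} (ha : 0 < a) (ι : Type) [Fintype ι] [DecidableEq ι] [Nonempty ι] :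
    ∃ δ w₀ R₀ θ₀ R₁ K : ℝ, 0 < δ ∧ 0 < R₀ ∧ 0 < θ₀ ∧ 0 < R₁ ∧ 0 < K ∧
      ∀ (mv kk r : ℕ), 1 ≤ kk → w₀ ≤ ((L ^ mv : ℕ) : ℝ) →
      ∀ {mm : Type} [Fintype mm] [DecidableEq mm] [Nonempty mm] (e : Matrix mm mm ℂ ≃L[ℝ] (ι → ℝ)), (∀ A B : Matrix mm mm ℂ, traceForm A B = e A ⬝ᵥ e B) →
      ∀ (A' : Fin (d + 1) → CvX' d L mv kk r hL → Matrix mm mm ℂ), (∀ μ x', (A' μ x')ᴴ = -A' μ x') →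
      ∀ (rA : ℝ), 0 ≤ rA → rA ≤ 1 → (∀ μ x', ‖A' μ x'‖ ≤ rA) →
        (∀ μ κ x', ‖A' μ (bshiftEquiv (cvM d L mv kk hL) (L ^ r * L ^ kk) κ x') - A' μ x'‖ ≤ rA * ((((L ^ r * L ^ kk : ℕ) : ℝ))⁻¹)) →
        (∀ μ κ x', ‖(A' μ (bshiftEquiv (cvM d L mv kk hL) (L ^ r * L ^ kk) κ x') - A' μ x') -
            (A' μ (bshiftEquiv (cvM d L mv kk hL) (L ^ r * L ^ kk) κ ((bshiftEquiv (cvM d L mv kk hL) (L ^ r * L ^ kk) μ).symm x')) -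
              A' μ ((bshiftEquiv (cvM d L mv kk hL) (L ^ r * L ^ kk) μ).symm x'))‖ ≤ rA * ((((L ^ r * L ^ kk : ℕ) : ℝ))⁻¹) * ((((L ^ r * L ^ kk : ℕ) : ℝ))⁻¹)) →
        2 * ((1 + Fintype.card (Fin (d + 1))) * ((3 + 2 * ((d : ℝ) + 1)) * rA)) ≤ 1 →
        (14 * Real.exp 1 * (1 + Fintype.card (Fin (d + 1))) * basisConst e * ((1 + Fintype.card (Fin (d + 1))) * ((3 + 2 * ((d : ℝ) + 1)) * rA))) * (1 + Fintype.card (Fin (d + 1) ⊕ Fin (d + 1))) + R₁ * (((1 + Fintype.card ι * (@basisConst ι _ (Matrix mm mm ℂ) Matrix.frobeniusNormedAddCommGroup Matrix.frobeniusNormedSpace e * (2 * Real.sqrt (Fintype.card mm)) * (Real.sqrt (Fintype.card mm) * (2 * (rA * ((((L ^ kk : ℕ) : ℝ))⁻¹)))))) ^ ((d + 2) * L ^ kk) - 1) + ((1 + Fintype.card ι * (@basisConst ι _ (Matrix mm mm ℂ) Matrix.frobeniusNormedAddCommGroup Matrix.frobeniusNormedSpace e * (2 * Real.sqrt (Fintype.card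 mm)) * (Real.sqrt (Fintype.card mm) * (2 * (rA * ((((L ^ r * L ^ kk : ℕ) : ℝ))⁻¹)))))) ^ ((d + 2) * (L ^ r * L ^ kk)) - 1)) ≤ R₀ →
        R₁ * (((1 + Fintype.card ι * (@basisConst ι _ (Matrix mm mm ℂ) Matrix.frobeniusNormedAddCommGroup Matrix.frobeniusNormedSpace e * (2 * Real.sqrt (Fintype.card mm)) * (Real.sqrt (Fintype.card mm) * (2 * (rA * ((((L ^ kk : ℕ) : ℝ))⁻¹)))))) ^ ((d + 2) * L ^ kk) - 1) + ((1 + Fintype.card ι * (@basisConst ι _ (Matrix mm mm ℂ) Matrix.frobeniusNormedAddCommGroup Matrix.frobeniusNormedSpace e * (2 * Real.sqrt (Fintype.card mm)) * (Real.sqrt (Fintype.card mm) * (2 * (rA * ((((L ^ r * L ^ kk : ℕ) : ℝ))⁻¹)))))) ^ ((d + 2) * (L ^ r * L ^ kk)) - 1)) ≤ θ₀ →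
        ((1 + Fintype.card ι * (@basisConst ι _ (Matrix mm mm ℂ) Matrix.frobeniusNormedAddCommGroup Matrix.frobeniusNormedSpace e * (2 * Real.sqrt (Fintype.card mm)) * (Real.sqrt (Fintype.card mm) * (2 * (rA * ((((L ^ kk : ℕ) : ℝ))⁻¹)))))) ^ ((d + 2) * L ^ kk) - 1) ≤ 1 → ((1 + Fintype.card ι * (@basisConst ι _ (Matrix mm mm ℂ) Matrix.frobeniusNormedAddCommGroup Matrix.frobeniusNormedSpace e * (2 * Real.sqrt (Fintype.card mm)) * (Real.sqrt (Fintype.card mm) * (2 * (rA * ((((L ^ r * L ^ kk : ℕ) : ℝ))⁻¹)))))) ^ ((d + 2) * (L ^ r * L ^ kk)) - 1) ≤ 1 →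
        HasMaj (CvNorm d L mv kk hL ι) (CvNorm d L mv kk hL ι) ((cvGlued d L mv kk hL a ((((L ^ kk : ℕ) : ℝ))⁻¹) ι e (fun _ _ => (1 : Matrix mm mm ℂ)) (fun μ x => NormedSpace.exp (((((L ^ kk : ℕ) : ℝ))⁻¹) • gavgM (Matrix mm mm ℂ) (Fin (d + 1)) (kingPrV L kk r (cvM d L mv kk hL)) A' μ x)) (cvNL d L mv kk hL a ι - (cvNVq d L mv kk hL a ι e (fun μ x => NormedSpace.exp (((((L ^ kk : ℕ) : ℝ))⁻¹) • gavgM (Matrix mm mm ℂ) (Fin (d + 1)) (kingPrV L kk r (cvM d L mv kk hL)) A' μ x)))) (fun _ => (cvNVq d L mv kk hL a ι e (fun μ x => NormedSpace.exp (((((L ^ kk : ℕ) : ℝ))⁻¹) • gavgM (Matrix mm mm ℂ) (Fin (d + 1)) (kingPrV L kk r (cvM d L mv kk hL)) A' μ x))))) - tensorId ι (gOp (cvM d L mv kk hL) (L ^ kk) a))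
          (fun y y' => K * (basisConst e * rA + (((1 + Fintype.card ι * (@basisConst ι _ (Matrix mm mm ℂ) Matrix.frobeniusNormedAddCommGroup Matrix.frobeniusNormedSpace e * (2 * Real.sqrt (Fintype.card mm)) * (Real.sqrt (Fintype.card mm) * (2 * (rA * ((((L ^ kk : ℕ) : ℝ))⁻¹)))))) ^ ((d + 2) * L ^ kk) - 1) + ((1 + Fintype.card ι * (@basisConst ι _ (Matrix mm mm ℂ) Matrix.frobeniusNormedAddCommGroup Matrix.frobeniusNormedSpace e * (2 * Real.sqrt (Fintype.card mm)) * (Real.sqrt (Fintype.card mm) * (2 * (rA * ((((L ^ r * L ^ kk : ℕ) : ℝ))⁻¹)))))) ^ ((d + 2) * (L ^ r * L ^ kk)) - 1))) * Real.exp (-(δ * (unitTorusGeo L kk (cvM d L mv kk hL)).dist y y'))) ∧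
        HasMaj (BlockNorm.ofBlocks (unitTorusGeo L kk (cvM d L mv kk hL)) (liftBlk (fun b : CvX' d L mv kk r hL => blockOf (L ^ r * L ^ kk) (cvM d L mv kk hL) b.1) ι)) (BlockNorm.ofBlocks (unitTorusGeo L kk (cvM d L mv kk hL)) (liftBlk (fun b : CvX' d L mv kk r hL => blockOf (L ^ r * L ^ kk) (cvM d L mv kk hL) b.1) ι)) ((cvGlued' d L mv kk r hL a ((((L ^ r * L ^ kk : ℕ) : ℝ))⁻¹) ι e (fun _ _ => (1 : Matrix mm mm ℂ)) (fun μ x' => NormedSpace.exp (((((L ^ r * L ^ kk : ℕ) : ℝ))⁻¹) • A' μ x')) (cvNL' d L mv kk r hL a ι - (cvNVq' d L mv kk r hL a ι e (fun μ x' => NormedSpace.exp (((((L ^ r * L ^ kk : ℕ) : ℝ))⁻¹) • A' μ x')))) (fun _ => (cvNVq' d L mv kk r hL a ι e (fun μ x' => NormedSpace.exp (((((L ^ r * L ^ kk : ℕ) : ℝ))⁻¹) • A' μ x'))))) - tensorId ι (gOp (cvM d L mv kk hL) (L ^ r * L ^ kk) a))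
          (fun y y' => K * (basisConst e * rA + (((1 + Fintype.card ι * (@basisConst ι _ (Matrix mm mm ℂ) Matrix.frobeniusNormedAddCommGroup Matrix.frobeniusNormedSpace e * (2 * Real.sqrt (Fintype.card mm)) * (Real.sqrt (Fintype.card mm) * (2 * (rA * ((((L ^ kk : ℕ) : ℝ))⁻¹)))))) ^ ((d + 2) * L ^ kk) - 1) + ((1 + Fintype.card ι * (@basisConst ι _ (Matrix mm mm ℂ) Matrix.frobeniusNormedAddCommGroup Matrix.frobeniusNormedSpace e * (2 * Real.sqrt (Fintype.card mm)) * (Real.sqrt (Fintype.card mm) * (2 * (rA * ((((L ^ r * L ^ kk : ℕ) : ℝ))⁻¹)))))) ^ ((d + 2) * (L ^ r * L ^ kk)) - 1))) * Real.exp (-(δ * (unitTorusGeo L kk (cvM d L mv kk hL)).dist y y'))) := by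
  have hLpos : 0 < L := Nat.pos_of_ne_zero (NeZero.ne L)
  have hL2 : 2 ≤ L := le_trans (by norm_num) hL7
  -- n15-c 191 (the live pair: majorant of `X_q` and `X_q(Δ_U + N_L − N_V^Q) = 1`) and FILE 21 (the flat family's uniform letters, rate `δ_G ≤ δ₁`)
  obtain ⟨δ₁, w₀, R₀, θ₀, R₁, B, hδ₁, hR₀, hθ₀, hR₁, hB, H⟩ := sfq_cvGlued_pair_spec (d := d) hL hL7 ha ι
  obtain ⟨δG, βG, m₀, cT, mT, hδG, hδG₁, hβG, -, -, -, -, HG⟩ := uniform_layer_fullGM₂ d ι hL.1 hL2 hL ha (γ := 1 / 16) (by norm_num) le_rfl 0 hδ₁ le_rfl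
  -- the row sums of Lemma 2.1 at the margins `δ_G∕2`, `δ_G∕4`, and the constants
  have hσ : 0 < δG / 2 := by positivity
  have hσ₄ : 0 < δG / 4 := by positivity
  set cr : ℝ := B4Sect5Proof.latticeConst (d + 1) (δG / 2) + 1 with hcr
  set c₄ : ℝ := B4Sect5Proof.latticeConst (d + 1) (δG / 4) + 1 with hc₄
  have hcr0 : 0 < cr := by have := B4Sect5Proof.latticeConst_nonneg (d + 1) hσ.le; rw [hcr]; linarith
  have hc₄0 : 0 < c₄ := by have := B4Sect5Proof.latticeConst_nonneg (d + 1) hσ₄.le; rw [hc₄]; linarith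
  have hcr1 : 1 ≤ cr := by have := B4Sect5Proof.latticeConst_nonneg (d + 1) hσ.le; rw [hcr]; linarith
  have hc₄1 : 1 ≤ c₄ := by have := B4Sect5Proof.latticeConst_nonneg (d + 1) hσ₄.le; rw [hc₄]; linarith
  set Rs : ℝ := 14 * Real.exp 1 * (1 + Fintype.card (Fin (d + 1))) * ((1 + Fintype.card (Fin (d + 1))) * (3 + 2 * ((d : ℝ) + 1))) * (1 + Fintype.card (Fin (d + 1) ⊕ Fin (d + 1)))
    with hRs
  have hRs0 : 0 < Rs := by positivity
  have hcG0 : 0 ≤ B4Sect5Proof.latticeConst (d + 1) δG := B4Sect5Proof.latticeConst_nonneg (d + 1) hδG.le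
  set Rq : ℝ := 3 * |a| * (B4Sect5Proof.latticeConst (d + 1) δG * Real.exp (3 * δG)) + 1 with hRq
  have hRq0 : 0 < Rq := by positivity
  set K : ℝ := B * Rs * βG * cr + B * Rq * βG * cr * c₄ + 1 with hK
  have hK1' : 0 ≤ B * Rs * βG * cr := by positivity
  have hK2' : 0 ≤ B * Rq * βG * cr * c₄ := by positivity
  have hKpos : 0 < K := by rw [hK]; linarith
  have hK1 : B * Rs * βG * cr ≤ K := by rw [hK]; linarith
  have hK2 : B * Rq * βG * cr * c₄ ≤ K := by rw [hK]; linarith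
  refine ⟨δG / 4, w₀, R₀, θ₀, R₁, K, hσ₄, hR₀, hθ₀, hR₁, hKpos, fun mv kk r hk hw₀ => ?_⟩
  intro mm _ _ _ e he A' hA' rA hrA hrA1 h1 h2 h3 hr2 hRle hθle hKc hKf
  have hkpos : (0 : ℝ) < ((L ^ kk : ℕ) : ℝ) := Nat.cast_pos.mpr (pow_pos hLpos kk)
  have hrkpos : (0 : ℝ) < ((L ^ r * L ^ kk : ℕ) : ℝ) := Nat.cast_pos.mpr (Nat.mul_pos (pow_pos hLpos r) (pow_pos hLpos kk))
  have hη : (0 : ℝ) < ((((L ^ kk : ℕ) : ℝ))⁻¹) := inv_pos.mpr hkpos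
  have hη' : (0 : ℝ) < ((((L ^ r * L ^ kk : ℕ) : ℝ))⁻¹) := inv_pos.mpr hrkpos
  have hN : ((((L ^ kk : ℕ) : ℝ))⁻¹) = ((L ^ r : ℕ) : ℝ) * ((((L ^ r * L ^ kk : ℕ) : ℝ))⁻¹) := by
    have hr0 : ((L ^ r : ℕ) : ℝ) ≠ 0 := Nat.cast_ne_zero.mpr (pow_ne_zero _ (NeZero.ne L))
    rw [Nat.cast_mul]; field_simp
  have hη1 : ((((L ^ kk : ℕ) : ℝ))⁻¹) ≤ 1 := inv_le_one_of_one_le₀ (by exact_mod_cast Nat.one_le_pow kk L hLpos)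
  have hη'1 : ((((L ^ r * L ^ kk : ℕ) : ℝ))⁻¹) ≤ 1 := inv_le_one_of_one_le₀ (by exact_mod_cast Nat.mul_pos (Nat.one_le_pow r L hLpos) (Nat.one_le_pow kk L hLpos))
  have hC₀ : (0 : ℝ) ≤ 2 * ((d : ℝ) + 1) := by positivity
  have hCθ : ((2 * ((d + 1) * (L ^ r - 1)) : ℕ) : ℝ) * ((((L ^ r * L ^ kk : ℕ) : ℝ))⁻¹) ≤ 2 * ((d : ℝ) + 1) * ((((L ^ kk : ℕ) : ℝ))⁻¹) := by
    have hsub : (((L ^ r - 1 : ℕ)) : ℝ) ≤ ((L ^ r : ℕ) : ℝ) := by exact_mod_cast Nat.sub_le _ _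
    have hcast : ((2 * ((d + 1) * (L ^ r - 1)) : ℕ) : ℝ) = 2 * ((d : ℝ) + 1) * (((L ^ r - 1 : ℕ)) : ℝ) := by push_cast; ring
    rw [hcast, hN]
    calc 2 * ((d : ℝ) + 1) * (((L ^ r - 1 : ℕ)) : ℝ) * ((((L ^ r * L ^ kk : ℕ) : ℝ))⁻¹) ≤ 2 * ((d : ℝ) + 1) * ((L ^ r : ℕ) : ℝ) * ((((L ^ r * L ^ kk : ℕ) : ℝ))⁻¹) :=
          mul_le_mul_of_nonneg_right (mul_le_mul_of_nonneg_left hsub hC₀) hη'.le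
      _ = 2 * ((d : ℝ) + 1) * (((L ^ r : ℕ) : ℝ) * ((((L ^ r * L ^ kk : ℕ) : ℝ))⁻¹)) := by ring
  -- King's pairing geometry and skewness in coordinates
  have hcomm := fun μ κ (x : CvX' d L mv kk r hL) => bshiftEquiv_comm (cvM d L mv kk hL) (L ^ r * L ^ kk) μ κ x
  have hconn := fun (f : CvX' d L mv kk r hL → Matrix mm mm ℂ) (β : ℝ)
      (hf : ∀ κ x, ‖f (bshiftEquiv (cvM d L mv kk hL) (L ^ r * L ^ kk) κ x) - f x‖ ≤ β) => fibre_conn_kingPrV L kk r (cvM d L mv kk hL) f β hf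
  have hblk := fun μ (x' : CvX' d L mv kk r hL) => kingPrV_bshiftEquiv_pow L kk r (cvM d L mv kk hL) μ x'
  have hAm : ∀ μ x, (gavgM (Matrix mm mm ℂ) (Fin (d + 1)) (kingPrV L kk r (cvM d L mv kk hL)) A' μ x)ᴴ = -gavgM (Matrix mm mm ℂ) (Fin (d + 1)) (kingPrV L kk r (cvM d L mv kk hL)) A' μ x := gavgM_conjTranspose_of_skew (kingPrV L kk r (cvM d L mv kk hL)) hA'
  have hA'c := fun μ x' => coordMat_adCLM_transpose_eq_neg_of_conjTranspose e he (hA' μ x')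
  have hAmc := fun μ x => coordMat_adCLM_transpose_eq_neg_of_conjTranspose e he (hAm μ x)
  obtain ⟨g1, -, -, -, -, -⟩ := gaugeLetters_of_mean (π := (kingPrV L kk r (cvM d L mv kk hL))) (s := bshiftEquiv (cvM d L mv kk hL) (L ^ kk))
    (s' := bshiftEquiv (cvM d L mv kk hL) (L ^ r * L ^ kk)) (N := L ^ r) (Cπ := (((2 * ((d + 1) * (L ^ r - 1)) : ℕ) : ℝ))) hcomm hconn hblk hη' hN hη hrA h1 h2 h3
  obtain ⟨hc, hcA, hc', hcA', -, -, -, -, -, -, -, -, -, -, -⟩ :=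
    twoSidedLetters_curvCoef_one_of_meanGauge e (π := (kingPrV L kk r (cvM d L mv kk hL))) (s := bshiftEquiv (cvM d L mv kk hL) (L ^ kk))
      (s' := bshiftEquiv (cvM d L mv kk hL) (L ^ r * L ^ kk)) (N := L ^ r) (θ := ((((L ^ kk : ℕ) : ℝ))⁻¹)) (Cπ := ((2 * ((d + 1) * (L ^ r - 1)) : ℕ) : ℝ)) (C₀ := 2 * ((d : ℝ) + 1))
      hcomm hconn hblk hη' hN hη hη1 le_rfl hC₀ hCθ hrA hr2 hA'c hAmc h1 h2 h3
  have hce : ∀ {X : Type} (η : ℝ) {A : Fin (d + 1) → X → Matrix mm mm ℂ}, (∀ μ x, (A μ x)ᴴ = -A μ x) →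
      (fun μ x => coordMat e (ContinuousLinearMap.mulLeftRight ℝ (Matrix mm mm ℂ) ((1 : Matrix mm mm ℂ) * NormedSpace.exp (η • A μ x) * (1 : Matrix mm mm ℂ)ᴴ)
        ((1 : Matrix mm mm ℂ) * NormedSpace.exp (η • A μ x) * (1 : Matrix mm mm ℂ)ᴴ)ᴴ)) = expTrField e η (fun μ x => adCLM ℝ (A μ x)) :=
    fun η _ hA => conj_one_exp_eq_expTrField e η hA
  rw [curvCoefC_one, curvCoefA_one, ← hce ((((L ^ kk : ℕ) : ℝ))⁻¹) hAm] at hc hcA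
  rw [curvCoefC_one, curvCoefA_one, ← hce ((((L ^ r * L ^ kk : ℕ) : ℝ))⁻¹) hA'] at hc' hcA'
  simp only [Matrix.conjTranspose_one, Matrix.mul_one, Matrix.one_mul] at hc hcA hc' hcA'
  -- 191 at this `A′`: the majorant of `X_q` and the right-inverse identity, both spacings
  obtain ⟨⟨hX, hXT, -⟩, ⟨hX', hXT', -⟩⟩ := H mv kk r hk hw₀ e he A' hA' rA hrA hrA1 h1 h2 h3 hr2 hRle hθle hKc hKf
  -- the transporter letters of `Ad e^{ηĀ′}`, `Ad e^{η′A′}` and the sizes of `N_V^Q`, `N_V^Q′` (n15-c 187a∕182b), BEFORE any abbreviation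
  have hexpc : Real.exp (((((L ^ kk : ℕ) : ℝ))⁻¹) * rA) - 1 ≤ 2 * (rA * ((((L ^ kk : ℕ) : ℝ))⁻¹)) := by
    have h := exp_sub_one_le_two_mul (x := ((((L ^ kk : ℕ) : ℝ))⁻¹) * rA) (by positivity) (mul_le_one₀ hη1 hrA hrA1); linarith [mul_comm ((((L ^ kk : ℕ) : ℝ))⁻¹) rA]
  have hκF := @basisConst_nonneg ι _ (Matrix mm mm ℂ) Matrix.frobeniusNormedAddCommGroup Matrix.frobeniusNormedSpace e
  have hTr : ∀ μ p i, ∑ j, |(cvT e (fun μ x => NormedSpace.exp (((((L ^ kk : ℕ) : ℝ))⁻¹) • gavgM (Matrix mm mm ℂ) (Fin (d + 1)) (kingPrV L kk r (cvM d L mv kk hL)) A' μ x)) μ p - 1) i j| ≤ Fintype.card ι * (@basisConst ι _ (Matrix mm mm ℂ) Matrix.frobeniusNormedAddCommGroup Matrix.frobeniusNormedSpace e * (2 * Real.sqrt (Fintype.card mm)) * (Real.sqrt (Fintype.card mm) * (2 * (rA * ((((L ^ kk : ℕ) : ℝ))⁻¹))))) := fun μ p i =>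
    (sf_rows_cvT_exp_sub_one_le e hη.le hAm g1 μ p i).trans (by gcongr)
  have hTc : ∀ μ p j, ∑ i, |(cvT e (fun μ x => NormedSpace.exp (((((L ^ kk : ℕ) : ℝ))⁻¹) • gavgM (Matrix mm mm ℂ) (Fin (d + 1)) (kingPrV L kk r (cvM d L mv kk hL)) A' μ x)) μ p - 1) i j| ≤ Fintype.card ι * (@basisConst ι _ (Matrix mm mm ℂ) Matrix.frobeniusNormedAddCommGroup Matrix.frobeniusNormedSpace e * (2 * Real.sqrt (Fintype.card mm)) * (Real.sqrt (Fintype.card mm) * (2 * (rA * ((((L ^ kk : ℕ) : ℝ))⁻¹))))) := fun μ p j =>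
    (sf_cols_cvT_exp_sub_one_le e hη.le hAm g1 μ p j).trans (by gcongr)
  have hρc0 : 0 ≤ Fintype.card ι * (@basisConst ι _ (Matrix mm mm ℂ) Matrix.frobeniusNormedAddCommGroup Matrix.frobeniusNormedSpace e * (2 * Real.sqrt (Fintype.card mm)) * (Real.sqrt (Fintype.card mm) * (2 * (rA * ((((L ^ kk : ℕ) : ℝ))⁻¹))))) := by positivity
  have hKC0 : 0 ≤ ((1 + Fintype.card ι * (@basisConst ι _ (Matrix mm mm ℂ) Matrix.frobeniusNormedAddCommGroup Matrix.frobeniusNormedSpace e * (2 * Real.sqrt (Fintype.card mm)) * (Real.sqrt (Fintype.card mm) * (2 * (rA * ((((L ^ kk : ℕ) : ℝ))⁻¹)))))) ^ ((d + 2) * L ^ kk) - 1) := by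
    have := one_le_pow₀ (M₀ := ℝ) (a := 1 + Fintype.card ι * (@basisConst ι _ (Matrix mm mm ℂ) Matrix.frobeniusNormedAddCommGroup Matrix.frobeniusNormedSpace e * (2 * Real.sqrt (Fintype.card mm)) * (Real.sqrt (Fintype.card mm) * (2 * (rA * ((((L ^ kk : ℕ) : ℝ))⁻¹)))))) (by linarith) (n := (d + 2) * L ^ kk); linarith
  have hKF0 : 0 ≤ ((1 + Fintype.card ι * (@basisConst ι _ (Matrix mm mm ℂ) Matrix.frobeniusNormedAddCommGroup Matrix.frobeniusNormedSpace e * (2 * Real.sqrt (Fintype.card mm)) * (Real.sqrt (Fintype.card mm) * (2 * (rA * ((((L ^ r * L ^ kk : ℕ) : ℝ))⁻¹)))))) ^ ((d + 2) * (L ^ r * L ^ kk)) - 1) := by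
    have hρf0 : 0 ≤ Fintype.card ι * (@basisConst ι _ (Matrix mm mm ℂ) Matrix.frobeniusNormedAddCommGroup Matrix.frobeniusNormedSpace e * (2 * Real.sqrt (Fintype.card mm)) * (Real.sqrt (Fintype.card mm) * (2 * (rA * ((((L ^ r * L ^ kk : ℕ) : ℝ))⁻¹))))) := by positivity
    have := one_le_pow₀ (M₀ := ℝ) (a := 1 + Fintype.card ι * (@basisConst ι _ (Matrix mm mm ℂ) Matrix.frobeniusNormedAddCommGroup Matrix.frobeniusNormedSpace e * (2 * Real.sqrt (Fintype.card mm)) * (Real.sqrt (Fintype.card mm) * (2 * (rA * ((((L ^ r * L ^ kk : ℕ) : ℝ))⁻¹)))))) (by linarith) (n := (d + 2) * (L ^ r * L ^ kk)); linarith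
  have hce : 0 ≤ B4Sect5Proof.latticeConst (d + 1) δG * Real.exp (3 * δG) := mul_nonneg hcG0 (Real.exp_nonneg _)
  have hconstC : |a| * (((1 + Fintype.card ι * (@basisConst ι _ (Matrix mm mm ℂ) Matrix.frobeniusNormedAddCommGroup Matrix.frobeniusNormedSpace e * (2 * Real.sqrt (Fintype.card mm)) * (Real.sqrt (Fintype.card mm) * (2 * (rA * ((((L ^ kk : ℕ) : ℝ))⁻¹)))))) ^ ((d + 2) * L ^ kk) - 1) * (2 + ((1 + Fintype.card ι * (@basisConst ι _ (Matrix mm mm ℂ) Matrix.frobeniusNormedAddCommGroup Matrix.frobeniusNormedSpace e * (2 * Real.sqrt (Fintype.card mm)) * (Real.sqrt (Fintype.card mm) * (2 * (rA * ((((L ^ kk : ℕ) : ℝ))⁻¹)))))) ^ ((d + 2) * L ^ kk) - 1)) * (B4Sect5Proof.latticeConst (d + 1) δG * Real.exp (3 * δG))) ≤ Rq * ((1 + Fintype.card ι * (@basisConst ι _ (Matrix mm mm ℂ) Matrix.frobeniusNormedAddCommGroup Matrix.frobeniusNormedSpace e * (2 * Real.sqrt (Fintype.card mm)) * (Real.sqrt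 (Fintype.card mm) * (2 * (rA * ((((L ^ kk : ℕ) : ℝ))⁻¹)))))) ^ ((d + 2) * L ^ kk) - 1) := by
    have h3 : ((1 + Fintype.card ι * (@basisConst ι _ (Matrix mm mm ℂ) Matrix.frobeniusNormedAddCommGroup Matrix.frobeniusNormedSpace e * (2 * Real.sqrt (Fintype.card mm)) * (Real.sqrt (Fintype.card mm) * (2 * (rA * ((((L ^ kk : ℕ) : ℝ))⁻¹)))))) ^ ((d + 2) * L ^ kk) - 1) * (2 + ((1 + Fintype.card ι * (@basisConst ι _ (Matrix mm mm ℂ) Matrix.frobeniusNormedAddCommGroup Matrix.frobeniusNormedSpace e * (2 * Real.sqrt (Fintype.card mm)) * (Real.sqrt (Fintype.card mm) * (2 * (rA * ((((L ^ kk : ℕ) : ℝ))⁻¹)))))) ^ ((d + 2) * L ^ kk) - 1)) ≤ 3 * ((1 + Fintype.card ι * (@basisConst ι _ (Matrix mm mm ℂ) Matrix.frobeniusNormedAddCommGroup Matrix.frobeniusNormedSpace e * (2 * Real.sqrt (Fintype.card mm)) * (Real.sqrt (Fintype.card mm) * (2 * (rA * ((((L ^ kk : ℕ) : ℝ))⁻¹))))))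 ^ ((d + 2) * L ^ kk) - 1) := by
      have hsq := mul_le_mul_of_nonneg_left hKc hKC0
      linarith only [hsq]
    calc |a| * (((1 + Fintype.card ι * (@basisConst ι _ (Matrix mm mm ℂ) Matrix.frobeniusNormedAddCommGroup Matrix.frobeniusNormedSpace e * (2 * Real.sqrt (Fintype.card mm)) * (Real.sqrt (Fintype.card mm) * (2 * (rA * ((((L ^ kk : ℕ) : ℝ))⁻¹)))))) ^ ((d + 2) * L ^ kk) - 1) * (2 + ((1 + Fintype.card ι * (@basisConst ι _ (Matrix mm mm ℂ) Matrix.frobeniusNormedAddCommGroup Matrix.frobeniusNormedSpace e * (2 * Real.sqrt (Fintype.card mm)) * (Real.sqrt (Fintype.card mm) * (2 * (rA * ((((L ^ kk : ℕ) : ℝ))⁻¹)))))) ^ ((d + 2) * L ^ kk) - 1)) * (B4Sect5Proof.latticeConst (d + 1) δG * Real.exp (3 * δG))) ≤ |a| * (3 * ((1 + Fintype.card ι * (@basisConst ι _ (Matrix mm mm ℂ) Matrix.frobeniusNormedAddCommGroup Matrix.frobeniusNormedSpace e * (2 * Real.sqrt (Fintype.card mm)) * (Real.sqrt (Fintype.card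 mm) * (2 * (rA * ((((L ^ kk : ℕ) : ℝ))⁻¹)))))) ^ ((d + 2) * L ^ kk) - 1) * (B4Sect5Proof.latticeConst (d + 1) δG * Real.exp (3 * δG))) := by gcongr
      _ = 3 * |a| * (B4Sect5Proof.latticeConst (d + 1) δG * Real.exp (3 * δG)) * ((1 + Fintype.card ι * (@basisConst ι _ (Matrix mm mm ℂ) Matrix.frobeniusNormedAddCommGroup Matrix.frobeniusNormedSpace e * (2 * Real.sqrt (Fintype.card mm)) * (Real.sqrt (Fintype.card mm) * (2 * (rA * ((((L ^ kk : ℕ) : ℝ))⁻¹)))))) ^ ((d + 2) * L ^ kk) - 1) := by ring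
      _ ≤ Rq * ((1 + Fintype.card ι * (@basisConst ι _ (Matrix mm mm ℂ) Matrix.frobeniusNormedAddCommGroup Matrix.frobeniusNormedSpace e * (2 * Real.sqrt (Fintype.card mm)) * (Real.sqrt (Fintype.card mm) * (2 * (rA * ((((L ^ kk : ℕ) : ℝ))⁻¹)))))) ^ ((d + 2) * L ^ kk) - 1) := mul_le_mul_of_nonneg_right (by rw [hRq]; exact (lt_add_one _).le) hKC0
  have hexpf : Real.exp (((((L ^ r * L ^ kk : ℕ) : ℝ))⁻¹) * rA) - 1 ≤ 2 * (rA * ((((L ^ r * L ^ kk : ℕ) : ℝ))⁻¹)) := by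
    have h := exp_sub_one_le_two_mul (x := ((((L ^ r * L ^ kk : ℕ) : ℝ))⁻¹) * rA) (by positivity) (mul_le_one₀ hη'1 hrA hrA1); linarith [mul_comm ((((L ^ r * L ^ kk : ℕ) : ℝ))⁻¹) rA]
  have hTr' : ∀ μ p i, ∑ j, |(cvT e (fun μ x' => NormedSpace.exp (((((L ^ r * L ^ kk : ℕ) : ℝ))⁻¹) • A' μ x')) μ p - 1) i j| ≤ Fintype.card ι * (@basisConst ι _ (Matrix mm mm ℂ) Matrix.frobeniusNormedAddCommGroup Matrix.frobeniusNormedSpace e * (2 * Real.sqrt (Fintype.card mm)) * (Real.sqrt (Fintype.card mm) * (2 * (rA * ((((L ^ r * L ^ kk : ℕ) : ℝ))⁻¹))))) := fun μ p i =>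
    (sf_rows_cvT_exp_sub_one_le e hη'.le hA' h1 μ p i).trans (by gcongr)
  have hTc' : ∀ μ p j, ∑ i, |(cvT e (fun μ x' => NormedSpace.exp (((((L ^ r * L ^ kk : ℕ) : ℝ))⁻¹) • A' μ x')) μ p - 1) i j| ≤ Fintype.card ι * (@basisConst ι _ (Matrix mm mm ℂ) Matrix.frobeniusNormedAddCommGroup Matrix.frobeniusNormedSpace e * (2 * Real.sqrt (Fintype.card mm)) * (Real.sqrt (Fintype.card mm) * (2 * (rA * ((((L ^ r * L ^ kk : ℕ) : ℝ))⁻¹))))) := fun μ p j =>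
    (sf_cols_cvT_exp_sub_one_le e hη'.le hA' h1 μ p j).trans (by gcongr)
  have hρf0 : 0 ≤ Fintype.card ι * (@basisConst ι _ (Matrix mm mm ℂ) Matrix.frobeniusNormedAddCommGroup Matrix.frobeniusNormedSpace e * (2 * Real.sqrt (Fintype.card mm)) * (Real.sqrt (Fintype.card mm) * (2 * (rA * ((((L ^ r * L ^ kk : ℕ) : ℝ))⁻¹))))) := by positivity
  have hconstF : |a| * (((1 + Fintype.card ι * (@basisConst ι _ (Matrix mm mm ℂ) Matrix.frobeniusNormedAddCommGroup Matrix.frobeniusNormedSpace e * (2 * Real.sqrt (Fintype.card mm)) * (Real.sqrt (Fintype.card mm) * (2 * (rA * ((((L ^ r * L ^ kk : ℕ) : ℝ))⁻¹)))))) ^ ((d + 2) * (L ^ r * L ^ kk)) - 1) * (2 + ((1 + Fintype.card ι * (@basisConst ι _ (Matrix mm mm ℂ) Matrix.frobeniusNormedAddCommGroup Matrix.frobeniusNormedSpace e * (2 * Real.sqrt (Fintype.card mm)) * (Real.sqrt (Fintype.card mm) * (2 * (rA * ((((L ^ r * L ^ kk : ℕ) : ℝ))⁻¹)))))) ^ ((d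 + 2) * (L ^ r * L ^ kk)) - 1)) * (B4Sect5Proof.latticeConst (d + 1) δG * Real.exp (3 * δG))) ≤ Rq * ((1 + Fintype.card ι * (@basisConst ι _ (Matrix mm mm ℂ) Matrix.frobeniusNormedAddCommGroup Matrix.frobeniusNormedSpace e * (2 * Real.sqrt (Fintype.card mm)) * (Real.sqrt (Fintype.card mm) * (2 * (rA * ((((L ^ r * L ^ kk : ℕ) : ℝ))⁻¹)))))) ^ ((d + 2) * (L ^ r * L ^ kk)) - 1) := by
    have h3 : ((1 + Fintype.card ι * (@basisConst ι _ (Matrix mm mm ℂ) Matrix.frobeniusNormedAddCommGroup Matrix.frobeniusNormedSpace e * (2 * Real.sqrt (Fintype.card mm)) * (Real.sqrt (Fintype.card mm) * (2 * (rA * ((((L ^ r * L ^ kk : ℕ) : ℝ))⁻¹)))))) ^ ((d + 2) * (L ^ r * L ^ kk)) - 1) * (2 + ((1 + Fintype.card ι * (@basisConst ι _ (Matrix mm mm ℂ) Matrix.frobeniusNormedAddCommGroup Matrix.frobeniusNormedSpace e * (2 * Real.sqrt (Fintype.card mm)) * (Real.sqrt (Fintype.card mm) * (2 * (rA * ((((L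 ^ r * L ^ kk : ℕ) : ℝ))⁻¹)))))) ^ ((d + 2) * (L ^ r * L ^ kk)) - 1)) ≤ 3 * ((1 + Fintype.card ι * (@basisConst ι _ (Matrix mm mm ℂ) Matrix.frobeniusNormedAddCommGroup Matrix.frobeniusNormedSpace e * (2 * Real.sqrt (Fintype.card mm)) * (Real.sqrt (Fintype.card mm) * (2 * (rA * ((((L ^ r * L ^ kk : ℕ) : ℝ))⁻¹)))))) ^ ((d + 2) * (L ^ r * L ^ kk)) - 1) := by
      have hsq := mul_le_mul_of_nonneg_left hKf hKF0
      linarith only [hsq]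
    calc |a| * (((1 + Fintype.card ι * (@basisConst ι _ (Matrix mm mm ℂ) Matrix.frobeniusNormedAddCommGroup Matrix.frobeniusNormedSpace e * (2 * Real.sqrt (Fintype.card mm)) * (Real.sqrt (Fintype.card mm) * (2 * (rA * ((((L ^ r * L ^ kk : ℕ) : ℝ))⁻¹)))))) ^ ((d + 2) * (L ^ r * L ^ kk)) - 1) * (2 + ((1 + Fintype.card ι * (@basisConst ι _ (Matrix mm mm ℂ) Matrix.frobeniusNormedAddCommGroup Matrix.frobeniusNormedSpace e * (2 * Real.sqrt (Fintype.card mm)) * (Real.sqrt (Fintype.card mm) * (2 * (rA * ((((L ^ r * L ^ kk : ℕ) : ℝ))⁻¹)))))) ^ ((d + 2) * (L ^ r * L ^ kk)) - 1)) * (B4Sect5Proof.latticeConst (d + 1) δG * Real.exp (3 * δG))) ≤ |a| * (3 * ((1 + Fintype.card ι * (@basisConst ι _ (Matrix mm mm ℂ) Matrix.frobeniusNormedAddCommGroup Matrix.frobeniusNormedSpace e * (2 * Real.sqrt (Fintype.card mm)) * (Real.sqrt (Fintype.card mm) * (2 * (rA * ((((L ^ r * L ^ kk : ℕ) : ℝ))⁻¹))))))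 ^ ((d + 2) * (L ^ r * L ^ kk)) - 1) * (B4Sect5Proof.latticeConst (d + 1) δG * Real.exp (3 * δG))) := by gcongr
      _ = 3 * |a| * (B4Sect5Proof.latticeConst (d + 1) δG * Real.exp (3 * δG)) * ((1 + Fintype.card ι * (@basisConst ι _ (Matrix mm mm ℂ) Matrix.frobeniusNormedAddCommGroup Matrix.frobeniusNormedSpace e * (2 * Real.sqrt (Fintype.card mm)) * (Real.sqrt (Fintype.card mm) * (2 * (rA * ((((L ^ r * L ^ kk : ℕ) : ℝ))⁻¹)))))) ^ ((d + 2) * (L ^ r * L ^ kk)) - 1) := by ring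
      _ ≤ Rq * ((1 + Fintype.card ι * (@basisConst ι _ (Matrix mm mm ℂ) Matrix.frobeniusNormedAddCommGroup Matrix.frobeniusNormedSpace e * (2 * Real.sqrt (Fintype.card mm)) * (Real.sqrt (Fintype.card mm) * (2 * (rA * ((((L ^ r * L ^ kk : ℕ) : ℝ))⁻¹)))))) ^ ((d + 2) * (L ^ r * L ^ kk)) - 1) := mul_le_mul_of_nonneg_right (by rw [hRq]; exact (lt_add_one _).le) hKF0
  -- abbreviations
  set M := cvM d L mv kk hL with hM
  set τ := bshiftEquiv (cvM d L mv kk hL) (L ^ kk) with hτ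
  set S : Fin (d + 1) → CvX d L mv kk hL → Matrix ι ι ℝ := fun μ x => coordMat e (ContinuousLinearMap.mulLeftRight ℝ (Matrix mm mm ℂ)
      (NormedSpace.exp (((((L ^ kk : ℕ) : ℝ))⁻¹) • gavgM (Matrix mm mm ℂ) (Fin (d + 1)) (kingPrV L kk r (cvM d L mv kk hL)) A' μ x))
      (NormedSpace.exp (((((L ^ kk : ℕ) : ℝ))⁻¹) • gavgM (Matrix mm mm ℂ) (Fin (d + 1)) (kingPrV L kk r (cvM d L mv kk hL)) A' μ x))ᴴ) with hS
  have htri := triangle254_unitTorusGeo L kk M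
  have hd := fun y y' => unitTorusGeo_dist_nonneg L kk M y y'
  have hrow₂ : RowSum (unitTorusGeo L kk M) (δG / 2) cr := fun y => (rowSum_unitTorusGeo L kk M hσ y).trans (by rw [hcr]; linarith)
  have hrow₄ : RowSum (unitTorusGeo L kk M) (δG / 4) c₄ := fun y => (rowSum_unitTorusGeo L kk M hσ₄ y).trans (by rw [hc₄]; linarith)
  have hκ0 : 0 ≤ basisConst e := basisConst_nonneg e
  have hRc0 : 0 ≤ 14 * Real.exp 1 * (1 + Fintype.card (Fin (d + 1))) * basisConst e * ((1 + Fintype.card (Fin (d + 1))) * ((3 + 2 * ((d : ℝ) + 1)) * rA)) := by positivity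
  have hRc : 14 * Real.exp 1 * (1 + Fintype.card (Fin (d + 1))) * basisConst e * ((1 + Fintype.card (Fin (d + 1))) * ((3 + 2 * ((d : ℝ) + 1)) * rA)) *
      (1 + Fintype.card (Fin (d + 1) ⊕ Fin (d + 1))) = Rs * basisConst e * rA := by rw [hRs]; ring
  -- the species row `V_R = unstackM (c, a±)` (M1 `hasMaj_unstackM`) composed with FILE 21's stacked `(G ⊗ 1, quotients)` (coarse)
  have hV : HasMaj (BlockNorm.ofBlocks (unitTorusGeo L kk M) (blkPair (liftBlk (cvBlk d L mv kk hL) ι))) (CvNorm d L mv kk hL ι)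
      (unstackM (tCoefC ((((L ^ kk : ℕ) : ℝ))⁻¹) (gaugePair τ S)) (tCoefA ((((L ^ kk : ℕ) : ℝ))⁻¹) (gaugePair τ S)))
      (diagK fun _ => 14 * Real.exp 1 * (1 + Fintype.card (Fin (d + 1))) * basisConst e * ((1 + Fintype.card (Fin (d + 1))) * ((3 + 2 * ((d : ℝ) + 1)) * rA)) *
        (1 + Fintype.card (Fin (d + 1) ⊕ Fin (d + 1)))) :=
    hasMaj_unstackM (g := unitTorusGeo L kk M) (cvBlk d L mv kk hL) hRc0 hc hcA
  obtain ⟨hG0, hD0, hG0', hD0', -⟩ := HG (⟨mv + 1, kk, hk, r⟩, (0 : Fin (d + 1)))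
  have hG : HasMaj (CvNorm d L mv kk hL ι) (CvNorm d L mv kk hL ι) (tensorId ι (gOp (M) (L ^ kk) a))
      (fun y y' => βG * Real.exp (-(δG * (unitTorusGeo L kk M).dist y y'))) := hG0
  have hD : ∀ μ, HasMaj (CvNorm d L mv kk hL ι) (CvNorm d L mv kk hL ι) (dPiecesM₂ d ι M (L ^ kk) a μ)
      (fun y y' => βG * Real.exp (-(δG * (unitTorusGeo L kk M).dist y y'))) := hD0
  have hSt : HasMaj (CvNorm d L mv kk hL ι) (BlockNorm.ofBlocks (unitTorusGeo L kk M) (blkPair (liftBlk (cvBlk d L mv kk hL) ι)))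
      (stack (tensorId ι (gOp M (L ^ kk) a)) (dPiecesM₂ d ι M (L ^ kk) a)) (fun y y' => βG * Real.exp (-(δG * (unitTorusGeo L kk M).dist y y'))) :=
    hasMaj_stack (g := unitTorusGeo L kk M) (liftBlk (cvBlk d L mv kk hL) ι) (fun _ _ => mul_nonneg hβG.le (Real.exp_nonneg _)) hG hD
  have hVG : HasMaj (CvNorm d L mv kk hL ι) (CvNorm d L mv kk hL ι)
      (speciesOpM τ ((L ^ kk : ℕ) : ℝ) (tCoefC ((((L ^ kk : ℕ) : ℝ))⁻¹) (gaugePair τ S)) (tCoefA ((((L ^ kk : ℕ) : ℝ))⁻¹) (gaugePair τ S)) ∘ₗ tensorId ι (gOp M (L ^ kk) a))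
      (fun y y' => 14 * Real.exp 1 * (1 + Fintype.card (Fin (d + 1))) * basisConst e * ((1 + Fintype.card (Fin (d + 1))) * ((3 + 2 * ((d : ℝ) + 1)) * rA)) *
        (1 + Fintype.card (Fin (d + 1) ⊕ Fin (d + 1))) * βG * Real.exp (-(δG * (unitTorusGeo L kk M).dist y y'))) := by
    rw [← unstackM_comp_stack_eq_speciesOpM_comp τ ((L ^ kk : ℕ) : ℝ) (tensorId ι (gOp M (L ^ kk) a)) _ _ (D := dPiecesM₂ d ι M (L ^ kk) a)
      (fun μ => dPiecesM₂_inl (d := d) (ι := ι) M (L ^ kk) a μ) (fun μ => dPiecesM₂_inr (d := d) (ι := ι) M (L ^ kk) a μ)]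
    exact hasMaj_diagK_comp_exp (g := unitTorusGeo L kk M) (blkPair (liftBlk (cvBlk d L mv kk hL) ι)) (mul_nonneg hRc0 (by positivity)) hV hSt
  -- `X_q ∘ V_R ∘ (G ⊗ 1)` ([B11] composition with rates; margin `δ_G∕2`), then slowed to `δ_G∕4`
  have hXVG := hasMaj_comp_exp (b₁ := CvNorm d L mv kk hL ι) (b₂ := CvNorm d L mv kk hL ι) (b₃ := CvNorm d L mv kk hL ι) (ρ := δG / 2) (σ := δG / 2)
    htri hd hrow₂ hB.le (by positivity) hσ.le (by linarith) (by linarith) hX hVG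
  have hA : HasMaj (CvNorm d L mv kk hL ι) (CvNorm d L mv kk hL ι)
      ((cvGlued d L mv kk hL a ((((L ^ kk : ℕ) : ℝ))⁻¹) ι e (fun _ _ => (1 : Matrix mm mm ℂ)) (fun μ x => NormedSpace.exp (((((L ^ kk : ℕ) : ℝ))⁻¹) • gavgM (Matrix mm mm ℂ) (Fin (d + 1)) (kingPrV L kk r (M)) A' μ x)) (cvNL d L mv kk hL a ι - (cvNVq d L mv kk hL a ι e (fun μ x => NormedSpace.exp (((((L ^ kk : ℕ) : ℝ))⁻¹) • gavgM (Matrix mm mm ℂ) (Fin (d + 1)) (kingPrV L kk r (M)) A' μ x)))) (fun _ => (cvNVq d L mv kk hL a ι e (fun μ x => NormedSpace.exp (((((L ^ kk : ℕ) : ℝ))⁻¹) • gavgM (Matrix mm mm ℂ) (Fin (d + 1)) (kingPrV L kk r (M)) A' μ x))))) ∘ₗ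
        speciesOpM τ ((L ^ kk : ℕ) : ℝ) (tCoefC ((((L ^ kk : ℕ) : ℝ))⁻¹) (gaugePair τ S)) (tCoefA ((((L ^ kk : ℕ) : ℝ))⁻¹) (gaugePair τ S)) ∘ₗ tensorId ι (gOp M (L ^ kk) a))
      (fun y y' => B * Rs * basisConst e * rA * βG * cr * Real.exp (-(δG / 4 * (unitTorusGeo L kk M).dist y y'))) := by
    refine (hasMaj_exp_mono hd (by positivity) (by linarith : δG / 4 ≤ δG / 2) (hXVG.mono fun y y' => le_of_eq ?_))
    rw [kappa_ofBlocks, hRs]; ring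
  -- the NEW summand: `X_q ∘ N_V^Q(U) ∘ (G ⊗ 1)` — n15-c∕182b `hasMaj_nvQ` with the transporter letters of `Ad e^{ηĀ′}`, sandwiched by (Q-1)
  have hNV : HasMaj (CvNorm d L mv kk hL ι) (CvNorm d L mv kk hL ι) (cvNVq d L mv kk hL a ι e (fun μ x => NormedSpace.exp (((((L ^ kk : ℕ) : ℝ))⁻¹) • gavgM (Matrix mm mm ℂ) (Fin (d + 1)) (kingPrV L kk r (M)) A' μ x)))
      (fun y y' => Rq * ((1 + Fintype.card ι * (@basisConst ι _ (Matrix mm mm ℂ) Matrix.frobeniusNormedAddCommGroup Matrix.frobeniusNormedSpace e * (2 * Real.sqrt (Fintype.card mm)) * (Real.sqrt (Fintype.card mm) * (2 * (rA * ((((L ^ kk : ℕ) : ℝ))⁻¹)))))) ^ ((d + 2) * L ^ kk) - 1) * Real.exp (-(δG * (unitTorusGeo L kk M).dist y y'))) := by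
    have h := hasMaj_nvQ (L := L) M kk (L ^ kk) (T := cvT e (fun μ x => NormedSpace.exp (((((L ^ kk : ℕ) : ℝ))⁻¹) • gavgM (Matrix mm mm ℂ) (Fin (d + 1)) (kingPrV L kk r (M)) A' μ x))) hρc0 hδG hTr hTc a
    refine h.mono fun y y' => ?_
    rw [unitTorusGeo_dist]
    exact mul_le_mul_of_nonneg_right hconstC (Real.exp_nonneg _)
  have hX₀ := hasMaj_exp_mono hd hB.le hδG₁ hX
  have hBterm := hasMaj_sandwich_exp_ofBlocks htri hd hδG.le hcr0.le hrow₂ hrow₄ hB.le (mul_nonneg hRq0.le hKC0) hβG.le hX₀ hNV hG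
  -- the increment identity, the sum, the constant
  have hid := sub_tensorId_gOp_eq_of_comp_eq_id_nv mv kk hL ha ι (gaugePair τ S) (cvNVq d L mv kk hL a ι e (fun μ x => NormedSpace.exp (((((L ^ kk : ℕ) : ℝ))⁻¹) • gavgM (Matrix mm mm ℂ) (Fin (d + 1)) (kingPrV L kk r (M)) A' μ x))) _ hXT
  constructor
  · refine ((hA.add hBterm).congr fun f => by rw [hid, LinearMap.add_comp, LinearMap.comp_add, LinearMap.add_apply]).mono fun y y' => ?_
    exact amp_incr_le hκ0 hrA hKC0 hKF0 (Real.exp_nonneg _) hKpos.le hK1 hK2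
  /- the FINE spacing `η′ = L^{−(r+k)}`: the same chain with the fine objects (blocks `blkFine ∘ kingPrV` = the cover's fine blocks, `blkFine_comp_kingPrV`) -/
  set τ' := bshiftEquiv (cvM d L mv kk hL) (L ^ r * L ^ kk) with hτ'
  set S' : Fin (d + 1) → CvX' d L mv kk r hL → Matrix ι ι ℝ := fun μ x' => coordMat e (ContinuousLinearMap.mulLeftRight ℝ (Matrix mm mm ℂ)
      (NormedSpace.exp (((((L ^ r * L ^ kk : ℕ) : ℝ))⁻¹) • A' μ x')) (NormedSpace.exp (((((L ^ r * L ^ kk : ℕ) : ℝ))⁻¹) • A' μ x'))ᴴ) with hS'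
  have hV' : HasMaj (BlockNorm.ofBlocks (unitTorusGeo L kk M) (blkPair (liftBlk (fun b : CvX' d L mv kk r hL => blockOf (L ^ r * L ^ kk) M b.1) ι)))
      (BlockNorm.ofBlocks (unitTorusGeo L kk M) (liftBlk (fun b : CvX' d L mv kk r hL => blockOf (L ^ r * L ^ kk) M b.1) ι))
      (unstackM (tCoefC ((((L ^ r * L ^ kk : ℕ) : ℝ))⁻¹) (gaugePair τ' S')) (tCoefA ((((L ^ r * L ^ kk : ℕ) : ℝ))⁻¹) (gaugePair τ' S')))
      (diagK fun _ => 14 * Real.exp 1 * (1 + Fintype.card (Fin (d + 1))) * basisConst e * ((1 + Fintype.card (Fin (d + 1))) * ((3 + 2 * ((d : ℝ) + 1)) * rA)) *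
        (1 + Fintype.card (Fin (d + 1) ⊕ Fin (d + 1)))) :=
    hasMaj_unstackM (g := unitTorusGeo L kk M) (fun b : CvX' d L mv kk r hL => blockOf (L ^ r * L ^ kk) M b.1) hRc0 hc' hcA'
  rw [blkFine_comp_kingPrV] at hG0' hD0'
  have hG' : HasMaj (BlockNorm.ofBlocks (unitTorusGeo L kk (M)) (liftBlk (fun b : CvX' d L mv kk r hL => blockOf (L ^ r * L ^ kk) (M) b.1) ι))
      (BlockNorm.ofBlocks (unitTorusGeo L kk (M)) (liftBlk (fun b : CvX' d L mv kk r hL => blockOf (L ^ r * L ^ kk) (M) b.1) ι)) (tensorId ι (gOp M (L ^ r * L ^ kk) a))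
      (fun y y' => βG * Real.exp (-(δG * (unitTorusGeo L kk M).dist y y'))) := hG0'
  have hD' : ∀ μ, HasMaj (BlockNorm.ofBlocks (unitTorusGeo L kk (M)) (liftBlk (fun b : CvX' d L mv kk r hL => blockOf (L ^ r * L ^ kk) (M) b.1) ι))
      (BlockNorm.ofBlocks (unitTorusGeo L kk (M)) (liftBlk (fun b : CvX' d L mv kk r hL => blockOf (L ^ r * L ^ kk) (M) b.1) ι)) (dPiecesM₂ d ι M (L ^ r * L ^ kk) a μ)
      (fun y y' => βG * Real.exp (-(δG * (unitTorusGeo L kk M).dist y y'))) := hD0'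
  have hSt' := hasMaj_stack (g := unitTorusGeo L kk M) (liftBlk (fun b : CvX' d L mv kk r hL => blockOf (L ^ r * L ^ kk) M b.1) ι)
    (fun _ _ => mul_nonneg hβG.le (Real.exp_nonneg _)) hG' hD'
  have hVG' : HasMaj (BlockNorm.ofBlocks (unitTorusGeo L kk (M)) (liftBlk (fun b : CvX' d L mv kk r hL => blockOf (L ^ r * L ^ kk) (M) b.1) ι))
      (BlockNorm.ofBlocks (unitTorusGeo L kk (M)) (liftBlk (fun b : CvX' d L mv kk r hL => blockOf (L ^ r * L ^ kk) (M) b.1) ι))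
      (speciesOpM τ' ((L ^ r * L ^ kk : ℕ) : ℝ) (tCoefC ((((L ^ r * L ^ kk : ℕ) : ℝ))⁻¹) (gaugePair τ' S')) (tCoefA ((((L ^ r * L ^ kk : ℕ) : ℝ))⁻¹) (gaugePair τ' S')) ∘ₗ
        tensorId ι (gOp M (L ^ r * L ^ kk) a))
      (fun y y' => 14 * Real.exp 1 * (1 + Fintype.card (Fin (d + 1))) * basisConst e * ((1 + Fintype.card (Fin (d + 1))) * ((3 + 2 * ((d : ℝ) + 1)) * rA)) *
        (1 + Fintype.card (Fin (d + 1) ⊕ Fin (d + 1))) * βG * Real.exp (-(δG * (unitTorusGeo L kk M).dist y y'))) := by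
    rw [← unstackM_comp_stack_eq_speciesOpM_comp τ' ((L ^ r * L ^ kk : ℕ) : ℝ) (tensorId ι (gOp M (L ^ r * L ^ kk) a)) _ _ (D := dPiecesM₂ d ι M (L ^ r * L ^ kk) a)
      (fun μ => dPiecesM₂_inl (d := d) (ι := ι) M (L ^ r * L ^ kk) a μ) (fun μ => dPiecesM₂_inr (d := d) (ι := ι) M (L ^ r * L ^ kk) a μ)]
    exact hasMaj_diagK_comp_exp (g := unitTorusGeo L kk M) (blkPair (liftBlk (fun b : CvX' d L mv kk r hL => blockOf (L ^ r * L ^ kk) M b.1) ι))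
      (mul_nonneg hRc0 (by positivity)) hV' hSt'
  have hXVG' := hasMaj_comp_exp (ρ := δG / 2) (σ := δG / 2) htri hd hrow₂ hB.le (by positivity) hσ.le (by linarith) (by linarith) hX' hVG'
  have hAf : HasMaj (BlockNorm.ofBlocks (unitTorusGeo L kk (M)) (liftBlk (fun b : CvX' d L mv kk r hL => blockOf (L ^ r * L ^ kk) (M) b.1) ι))
      (BlockNorm.ofBlocks (unitTorusGeo L kk (M)) (liftBlk (fun b : CvX' d L mv kk r hL => blockOf (L ^ r * L ^ kk) (M) b.1) ι))
      ((cvGlued' d L mv kk r hL a ((((L ^ r * L ^ kk : ℕ) : ℝ))⁻¹) ι e (fun _ _ => (1 : Matrix mm mm ℂ)) (fun μ x' => NormedSpace.exp (((((L ^ r * L ^ kk : ℕ) : ℝ))⁻¹) • A' μ x')) (cvNL' d L mv kk r hL a ι - (cvNVq' d L mv kk r hL a ι e (fun μ x' => NormedSpace.exp (((((L ^ r * L ^ kk : ℕ) : ℝ))⁻¹) • A' μ x')))) (fun _ => (cvNVq' d L mv kk r hL a ι e (fun μ x' => NormedSpace.exp (((((L ^ r * L ^ kk : ℕ) : ℝ))⁻¹)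 • A' μ x'))))) ∘ₗ
        speciesOpM τ' ((L ^ r * L ^ kk : ℕ) : ℝ) (tCoefC ((((L ^ r * L ^ kk : ℕ) : ℝ))⁻¹) (gaugePair τ' S')) (tCoefA ((((L ^ r * L ^ kk : ℕ) : ℝ))⁻¹) (gaugePair τ' S')) ∘ₗ
          tensorId ι (gOp M (L ^ r * L ^ kk) a))
      (fun y y' => B * Rs * basisConst e * rA * βG * cr * Real.exp (-(δG / 4 * (unitTorusGeo L kk M).dist y y'))) := by
    refine (hasMaj_exp_mono hd (by positivity) (by linarith : δG / 4 ≤ δG / 2) (hXVG'.mono fun y y' => le_of_eq ?_))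
    rw [kappa_ofBlocks, hRs]; ring
  have hNVf : HasMaj (BlockNorm.ofBlocks (unitTorusGeo L kk (M)) (liftBlk (fun b : CvX' d L mv kk r hL => blockOf (L ^ r * L ^ kk) (M) b.1) ι))
      (BlockNorm.ofBlocks (unitTorusGeo L kk (M)) (liftBlk (fun b : CvX' d L mv kk r hL => blockOf (L ^ r * L ^ kk) (M) b.1) ι)) (cvNVq' d L mv kk r hL a ι e (fun μ x' => NormedSpace.exp (((((L ^ r * L ^ kk : ℕ) : ℝ))⁻¹) • A' μ x')))
      (fun y y' => Rq * ((1 + Fintype.card ι * (@basisConst ι _ (Matrix mm mm ℂ) Matrix.frobeniusNormedAddCommGroup Matrix.frobeniusNormedSpace e * (2 * Real.sqrt (Fintype.card mm)) * (Real.sqrt (Fintype.card mm) * (2 * (rA * ((((L ^ r * L ^ kk : ℕ) : ℝ))⁻¹)))))) ^ ((d + 2) * (L ^ r * L ^ kk)) - 1) * Real.exp (-(δG * (unitTorusGeo L kk M).dist y y'))) := by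
    have h := hasMaj_nvQ (L := L) M kk (L ^ r * L ^ kk) (T := cvT e (fun μ x' => NormedSpace.exp (((((L ^ r * L ^ kk : ℕ) : ℝ))⁻¹) • A' μ x'))) hρf0 hδG hTr' hTc' a
    refine h.mono fun y y' => ?_
    rw [unitTorusGeo_dist]
    exact mul_le_mul_of_nonneg_right hconstF (Real.exp_nonneg _)
  have hX₀' := hasMaj_exp_mono hd hB.le hδG₁ hX'
  have hBterm' := hasMaj_sandwich_exp_ofBlocks htri hd hδG.le hcr0.le hrow₂ hrow₄ hB.le (mul_nonneg hRq0.le hKF0) hβG.le hX₀' hNVf hG'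
  have hid' := sub_tensorId_gOp_eq_of_comp_eq_id_nv_fine mv kk r hL ha ι (gaugePair τ' S') (cvNVq' d L mv kk r hL a ι e (fun μ x' => NormedSpace.exp (((((L ^ r * L ^ kk : ℕ) : ℝ))⁻¹) • A' μ x'))) _ hXT'
  refine ((hAf.add hBterm').congr fun f => by rw [hid', LinearMap.add_comp, LinearMap.comp_add, LinearMap.add_apply]).mono fun y y' => ?_
  exact amp_incr_le' hκ0 hrA hKC0 hKF0 (Real.exp_nonneg _) hKpos.le hK1 hK2

end Letter


end Summit.QuantumFields.YangMills.BalabanUVNodes.N15.GluedZeroField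

end
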